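import Literature.Topology.FourManifolds.FlowerReflectionLoops
import HarnessLib

/-!
# The reflection on the access path of the flower sector: `[γ⁻¹ · σ(γ)] = [loop b]⁻¹`

Topic `Literature/Topology/FourManifolds`; `π₁`-bookkeeping (W2) brick of the Dehn–Nielsen–Baer seat
(`DehnNielsenBaerSurface.lean`), sequel of `FlowerReflectionLoops.lean`.  The marking of `π₁(Z_g, 0⁺)`
(`FlowerMarkingValues.lean`) transports the basis loops at `P` to the pole `0⁺` along the access
path `γ = w · m` (`FlowerSectorWord.gam`).  The reflection `σ` does NOT fix `γ`: `σ(γ)` runs down the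
mirror valley, and the loop `γ⁻¹ · σ(γ)` at `P` encircles the lens hole.  Read through the end map
(`fromPath_cl_eq_emap`, a retraction onto the reduced spine): `γ` reads the upper lens edge `x`
(`cl_emap_gam`), `σ(γ)` the lower lens edge `y` (mirror of `x`), so

  `[γ⁻¹ · σ(γ)] = x⁻¹ · y = (y⁻¹ · x)⁻¹ = [loopR b]⁻¹`  (`cl_loopR_b`).

Consequently `σ_#` on the marking classes at the pole is the handle involution
`a ↦ b⁻¹ a b` (or its conjugate form), `b ↦ b⁻¹` realised algebraically by `SurfaceGroup.reflEquiv`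
(`SurfaceGroupReflection.lean`), not the naive `a ↦ a, b ↦ b⁻¹`.

* `FlowerModel.refl3Gam` — the mirrored access path `σ ∘ γ : 0⁺ ⟶ P` (cast along `σ(0⁺) = 0⁺`,
  `σ(P) = P`);
* `FlowerModel.cl_gam_symm_trans_refl3Gam` — **`cl (γ⁻¹ · σ(γ)) = (cl (loopR b))⁻¹`** in the
  homotopy quotient of the sector at `P`.

Everything is proved; one auxiliary definition (`refl3Gam`); no named facts (D-0026).

## References

* H. Zieschang, E. Vogt, H.-D. Coldewey, *Surfaces and Planar Discontinuous Groups*, LNM 835 (1980),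
  §3.2. [ZieschangVogtColdewey1980]
* A. Hatcher, *Algebraic Topology* (2002), Prop. 1.17 (retraction formula). [HatcherAT2002]
* B. Farb, D. Margalit, *A primer on mapping class groups* (2012), Thm. 8.1. [FarbMargalit2012]
-/

open scoped Topology Real unitInterval
open Set Function Metric

noncomputable section

namespace Literature.Topology.FourManifolds

/-- Local notation: `𝔼 n` is the model Euclidean space `EuclideanSpace ℝ (Fin n)`. -/
local notation "𝔼 " n:arg => EuclideanSpace ℝ (Fin n)

open PlanarThickening PlanarDouble Literature.AlgebraicTopology.Homotopy
  Literature.AlgebraicTopology.FundamentalGroup Literature.AlgebraicTopology.FundamentalGroup.EdgePath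

namespace FlowerModel

variable {g : ℕ}

/-- **The mirrored access path** `σ ∘ γ` from the pole `0⁺` to `P`. [folklore] -/
def refl3Gam (hg : 2 ≤ g) : Path (top g) (ptP g) :=
  ((gam hg).map refl3.continuous).cast (refl3_top g).symm (refl3_ptP g).symm

/-- The mirrored access path stays in the sector. [folklore] -/
theorem refl3Gam_mem (hg : 2 ≤ g) (t : I) : refl3Gam hg t ∈ sectorZ g := by
  rw [refl3Gam, Path.cast_coe]
  exact map_refl3_mem (gam_mem hg) hg t

/-- The loop `γ⁻¹ · σ(γ)` at `P` stays in the sector. [folklore] -/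
theorem gam_symm_trans_refl3Gam_mem (hg : 2 ≤ g) (t : I) :
    ((gam hg).symm.trans (refl3Gam hg)) t ∈ sectorZ g :=
  VanKampen.trans_mem (VanKampen.symm_mem (gam_mem hg)) (refl3Gam_mem hg) t

/-- The end map of the mirrored access path reads the lower lens edge `y`. [folklore] -/
theorem cl_emap_map_refl3_gam (hg : 2 ≤ g)
    (h' : ∀ t, emap hg ((gam hg).map refl3.continuous) (map_refl3_mem (gam_mem hg) hg) t ∈ sectorZ g) :
    cl (emap hg ((gam hg).map refl3.continuous) (map_refl3_mem (gam_mem hg) hg)) h' =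
      (atomY hg).cast
        (Subtype.ext (show endMapI hg (refl3 (top g)) = ptI hg by rw [refl3_top, endMap_top]))
        (Subtype.ext (show endMapI hg (refl3 (ptP g)) = ptP g by rw [refl3_ptP, endMap_ptP])) := by
  rw [cl_emap_map_refl3 hg (gam hg) (gam_mem hg) h',
    cl_eq_atomY hg _ (isParamOn_map_refl3_of_Lup hg (isParamOn_emap_gam hg))
      (show refl3 (endMapI hg (top g)) = ptI hg by rw [endMap_top, refl3_ptI])
      (show refl3 (endMapI hg (ptP g)) = ptP g by rw [endMap_ptP, refl3_ptP])]
  simp only [Path.Homotopic.Quotient.cast_cast]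

/-- **`[γ⁻¹ · σ(γ)] = [loopR b]⁻¹`** in the homotopy quotient of the sector at `P`: the loop down the
access path and back up its mirror image encircles the lens hole once, against the `b`-loop.
[cite: ZieschangVogtColdewey1980, §3.2] [cite: HatcherAT2002, Prop. 1.17] -/
theorem cl_gam_symm_trans_refl3Gam (hg : 2 ≤ g) :
    cl ((gam hg).symm.trans (refl3Gam hg)) (gam_symm_trans_refl3Gam_mem hg) =
      (cl (loopR hg (0, true)) (loopR_mem_sectorZ hg (0, true))).symm := by
  -- read the loop through the end map
  have hread := fromPath_cl_eq_emap hg ((gam hg).symm.trans (refl3Gam hg)) (gam_symm_trans_refl3Gam_mem hg)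
  change cl ((gam hg).symm.trans (refl3Gam hg)) (gam_symm_trans_refl3Gam_mem hg) = _ at hread
  rw [hread, cl_cast_split _ (emap_mem hg _ _),
    cl_emap_trans hg _ _ (VanKampen.symm_mem (gam_mem hg)) (refl3Gam_mem hg),
    cl_emap_symm hg _ (gam_mem hg), cl_emap_gam hg (gam_mem hg)]
  dsimp only [refl3Gam]
  rw [cl_emap_cast hg _ (map_refl3_mem (gam_mem hg) hg), cl_emap_map_refl3_gam hg, cl_loopR_b hg]
  simp only [symm_cast, cast_trans_cast, Path.Homotopic.Quotient.cast_cast, cast_eq_self, quot_symm_trans,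
    quot_symm_symm]

end FlowerModel

end Literature.Topology.FourManifolds

end
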